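import Mathlib
import Summits.PneNP.PneNP.Theorems.ClusUniversalCertificateCoordZeroFree

/-!
# Route ClusUniversalCertificate, crux `UniversalCertAll` (stmt-PneNP-19683) — the SUPPLY LEMMA for full flats

Support file (`--supports stmt-PneNP-19683`), objects of record `…Theorems.ClusCoord` (`bsize`, `zcount`) and the block
projection `ClusCoordZeroFree.blockProj` (p-landed file `ClusUniversalCertificateCoordZeroFree.lean`).

**Supply lemma (`pow_le_card_filter_of_flat`, `pow_le_zcount_of_flat`).**  If a flat `A ⊆ Y ⊆ 𝔽₂^M` contains a point `a₀`,
then at least `2^(dim A − b_j)` points of `Y` agree with `a₀` on block `j`; in particular a flat inside `Y` meeting the zero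
fibre of block `j` supplies `2^(dim A − b_j) ≤ Z_j(Y)` block-`j` zeros.  Proof: the points of `A` agreeing with `a₀` on block `j`
form the coset `a₀ + (A.direction ⊓ ker π_j)`, and `dim (A.direction ⊓ ker π_j) ≥ dim A − rank π_j ≥ dim A − b_j` by rank–nullity
for `π_j` restricted to `A.direction` (`finrank_range_blockProj_le`: the block projection has rank `≤ b_j`).

USE.  This is the quantitative half of every argument about FULL points of the hard core of `stub_core` (registered skeleton
`Cruxes/UniversalCertAll/Lines/slicing.lean`): a point whose optimal flat is onto block `j` (so meets every fibre of block `j`)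
certifies `2^(M − acodim − b_j) ≤ Z_j(Y)`, i.e. `acodim ≥ M − b_j − log₂ Z_j(Y)`; on zero-rare sets this is the only lower bound on
the certificate codimension of full points available in the record.  HONEST FRAMING: a support lemma; the crux is OPEN; FRONTIER
rung F-N1 — nothing here bears on P vs NP.
-/

set_option linter.dupNamespace false -- `Summit.PneNP.PneNP.…`: summit = sub-problem name (D-0017 single-conjunct layout)

namespace Summit.PneNP.PneNP.Theorems.ClusCoordSupply

open Finset
open Summit.PneNP.PneNP.Theorems.ClusCoord (bsize zcount)
open Summit.PneNP.PneNP.Theorems.ClusCoordZeroFree (blockProj blockProj_apply blockProj_eq_zero_iff)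

variable {M n : ℕ}

/-- The block-`j` projection has rank at most `b_j`: its range is spanned by the unit vectors of block `j`. -/
theorem finrank_range_blockProj_le (blk : Fin M → Fin n) (j : Fin n) :
    Module.finrank (ZMod 2) (LinearMap.range (blockProj blk j)) ≤ bsize blk j := by
  classical
  let S : Set (Fin M → ZMod 2) :=
    Set.range fun i : {i : Fin M // blk i = j} => Pi.single (i : Fin M) (1 : ZMod 2)
  have hle : LinearMap.range (blockProj blk j) ≤ Submodule.span (ZMod 2) S := by
    rintro _ ⟨v, rfl⟩
    have hv : blockProj blk j v = ∑ i : Fin M, Pi.single i (blockProj blk j v i) := by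
      rw [Finset.univ_sum_single]
    rw [hv]
    refine Submodule.sum_mem _ fun i _ => ?_
    by_cases hi : blk i = j
    · have hs : Pi.single i (blockProj blk j v i) = (v i) • Pi.single i (1 : ZMod 2) := by
        rw [blockProj_apply, if_pos hi, ← Pi.single_smul, smul_eq_mul, mul_one]
      rw [hs]
      exact Submodule.smul_mem _ _ (Submodule.subset_span ⟨⟨i, hi⟩, rfl⟩)
    · rw [blockProj_apply, if_neg hi, Pi.single_zero]
      exact Submodule.zero_mem _
  calc Module.finrank (ZMod 2) (LinearMap.range (blockProj blk j))
      ≤ Module.finrank (ZMod 2) (Submodule.span (ZMod 2) S) := Submodule.finrank_mono hle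
    _ ≤ (S.toFinset).card := finrank_span_le_card S
    _ ≤ Fintype.card {i : Fin M // blk i = j} := by
        rw [Set.toFinset_range]
        exact Finset.card_image_le.trans (by simp)
    _ = bsize blk j := by
        rw [Fintype.card_subtype]; rfl

/-- Rank–nullity for the block projection on the direction of a flat: the part of `A.direction` inside `ker π_j` has
dimension at least `dim A − b_j`. -/
theorem finrank_direction_le (blk : Fin M → Fin n) (j : Fin n) (D : Submodule (ZMod 2) (Fin M → ZMod 2)) :
    Module.finrank (ZMod 2) D ≤
      bsize blk j + Module.finrank (ZMod 2) (D ⊓ LinearMap.ker (blockProj blk j) : Submodule (ZMod 2) (Fin M → ZMod 2)) := by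
  let f : D →ₗ[ZMod 2] (Fin M → ZMod 2) := (blockProj blk j).comp D.subtype
  have hrn := LinearMap.finrank_range_add_finrank_ker f
  have h1 : Module.finrank (ZMod 2) (LinearMap.range f) ≤ bsize blk j := by
    have : LinearMap.range f ≤ LinearMap.range (blockProj blk j) := by
      rw [LinearMap.range_comp]; exact LinearMap.map_le_range
    exact (Submodule.finrank_mono this).trans (finrank_range_blockProj_le blk j)
  have h2 : Module.finrank (ZMod 2) (LinearMap.ker f) =
      Module.finrank (ZMod 2) (D ⊓ LinearMap.ker (blockProj blk j) : Submodule (ZMod 2) (Fin M → ZMod 2)) := by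
    have : (LinearMap.ker f).map D.subtype = D ⊓ LinearMap.ker (blockProj blk j) := by
      rw [LinearMap.ker_comp, Submodule.map_comap_subtype]
    rw [← this, Submodule.finrank_map_subtype_eq]
  omega

/-- **Supply lemma (fibre form).**  If the flat `A ⊆ Y` contains `a₀`, then at least `2^(dim A − b_j)` points of `Y` agree with
`a₀` on block `j`. -/
theorem pow_le_card_filter_of_flat (blk : Fin M → Fin n) (j : Fin n) (Y : Finset (Fin M → ZMod 2))
    (A : AffineSubspace (ZMod 2) (Fin M → ZMod 2)) (hA : ∀ z ∈ A, z ∈ Y)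
    (a₀ : Fin M → ZMod 2) (ha₀ : a₀ ∈ A) :
    2 ^ (Module.finrank (ZMod 2) A.direction - bsize blk j) ≤
      (Y.filter fun y => ∀ i, blk i = j → y i = a₀ i).card := by
  classical
  set W : Submodule (ZMod 2) (Fin M → ZMod 2) := A.direction ⊓ LinearMap.ker (blockProj blk j) with hW
  -- the coset `a₀ + W` lies in the fibre of `a₀`
  let φ : W → {y // y ∈ Y.filter fun y => ∀ i, blk i = j → y i = a₀ i} := fun w =>
    ⟨(w : Fin M → ZMod 2) + a₀, by
      rw [Finset.mem_filter]
      have hw : (w : Fin M → ZMod 2) ∈ A.direction ⊓ LinearMap.ker (blockProj blk j) := hW ▸ w.2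
      rw [Submodule.mem_inf, LinearMap.mem_ker, blockProj_eq_zero_iff] at hw
      refine ⟨hA _ ?_, fun i hi => ?_⟩
      · have := AffineSubspace.vadd_mem_of_mem_direction hw.1 ha₀
        simpa [vadd_eq_add] using this
      · simp [hw.2 i hi]⟩
  have hφ : Function.Injective φ := by
    intro w w' h
    have : (w : Fin M → ZMod 2) + a₀ = (w' : Fin M → ZMod 2) + a₀ := congrArg Subtype.val h
    exact Subtype.ext (add_right_cancel this)
  have hcard : Nat.card W ≤ (Y.filter fun y => ∀ i, blk i = j → y i = a₀ i).card := by
    have := Nat.card_le_card_of_injective φ hφ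
    rwa [Nat.card_eq_fintype_card (α := {y // y ∈ Y.filter fun y => ∀ i, blk i = j → y i = a₀ i}),
      Fintype.card_coe] at this
  have hW' : Nat.card W = 2 ^ Module.finrank (ZMod 2) W := by
    rw [Module.natCard_eq_pow_finrank (K := ZMod 2) (V := W), Nat.card_eq_fintype_card, ZMod.card]
  have hdim : Module.finrank (ZMod 2) A.direction - bsize blk j ≤ Module.finrank (ZMod 2) W := by
    have := finrank_direction_le blk j A.direction
    rw [← hW] at this
    omega
  calc 2 ^ (Module.finrank (ZMod 2) A.direction - bsize blk j)
      ≤ 2 ^ Module.finrank (ZMod 2) W := Nat.pow_le_pow_right (by norm_num) hdim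
    _ = Nat.card W := hW'.symm
    _ ≤ _ := hcard

/-- **Supply lemma (zero form).**  A flat inside `Y` meeting the zero fibre of block `j` supplies `2^(dim A − b_j) ≤ Z_j(Y)`
block-`j` zeros. -/
theorem pow_le_zcount_of_flat (blk : Fin M → Fin n) (j : Fin n) (Y : Finset (Fin M → ZMod 2))
    (A : AffineSubspace (ZMod 2) (Fin M → ZMod 2)) (hA : ∀ z ∈ A, z ∈ Y)
    (a₀ : Fin M → ZMod 2) (ha₀ : a₀ ∈ A) (hz : ∀ i, blk i = j → a₀ i = 0) :
    2 ^ (Module.finrank (ZMod 2) A.direction - bsize blk j) ≤ zcount blk j Y := by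
  have h := pow_le_card_filter_of_flat blk j Y A hA a₀ ha₀
  have he : (Y.filter fun y => ∀ i, blk i = j → y i = a₀ i) = (Y.filter fun y => ∀ i, blk i = j → y i = 0) := by
    apply Finset.filter_congr
    intro y _
    constructor
    · intro hy i hi; rw [hy i hi, hz i hi]
    · intro hy i hi; rw [hy i hi, hz i hi]
  unfold zcount
  rwa [he] at h

end Summit.PneNP.PneNP.Theorems.ClusCoordSupply
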